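/-
# Sylow frames: Borel normal forms for p-torsion subgroups of `GL₂(𝔽_p)`

Cell B2b-5 (`b2b-lgcu-borel`, generation 14), supporting the crux `SubgroupIdentityDesigns`
(`stmt-MatrixMultiplication-14079`) of the route `LevelGradedCohnUmans`.

HONEST FRAMING.  VALUE = THEOREM (structure theorems for the decidable `(m,k) = (2,1)` cell of
the crux, exported for successor work on its p′-members) — NOT summit progress.
-/
import Summits.MatrixMultiplication.MatrixMultiplication.Theorems.SubgroupIdentityDesigns.Negative.Transvections
import Summits.MatrixMultiplication.MatrixMultiplication.Theorems.SubgroupIdentityDesigns.Negative.DecoratedSylowLaw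
import Summits.MatrixMultiplication.MatrixMultiplication.Theorems.SubgroupIdentityDesigns.Negative.StandardLines

/-!
## Statements

The packing laws `disjoint_product_le` (two members) and `threeSylow_volume_le` (three members)
derive, inside their proofs, a normal form for p-torsion subgroups; this file EXPORTS the normal
forms themselves, so that later work (the p′-member analysis of the `(2,1)` cell) can start from
them.

* `exists_borel_frame_of_disjoint`: if `H ∩ H' = 1` and `p ∣ |H|`, `p ∣ |H'|`, there is a frame
  `c ∈ GL₂(𝔽_p)` with `U⁺ ≤ c⁻¹ H c ≤ B⁺` and `U⁻ ≤ c⁻¹ H' c ≤ B⁻` (shape hypotheses on entries,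
  exactly in the form consumed by `DecoratedSylowShapes` / `DecoratedSylowLaw`).
* `exists_borel_frame_of_tpp`: the same for two members of a subgroup TPP triple, together with the
  transported TPP for the conjugated triple.
* `exists_decorated_frame_of_threeSylow`: a subgroup TPP triple with `p ∣ |Hᵢ|` (`i = 1,2,3`) is
  conjugate to a decorated-Sylow triple `U⁺ ≤ K₁ ≤ B⁺`, `U_{[1:1]} ≤ K₂ ≤ Stab[1:1]`,
  `U⁻ ≤ K₃ ≤ B⁻` (the six hypotheses of `decoratedSylow_volume_le`, verbatim).

Proofs: as in `TwoSylowLaw` / `ThreeSylowLaw` (Cauchy transvections, distinct fixed lines, explicit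
frame, root lemma `lower_mem_of_upper_mem`, disjointness).

Report: `run/shared/lean/b2b/levelgraded-cu/ORACLE-g14.md` §G14-5.  Sorry-free; no new definitions.
-/

set_option linter.dupNamespace false

noncomputable section

open scoped BigOperators Classical
open Summit.MatrixMultiplication.MatrixMultiplication.Theorems.LieRankDesigns.Negative (GLm Mat)

namespace Summit.MatrixMultiplication.MatrixMultiplication.Theorems.SubgroupIdentityDesigns.Negative

section SylowFrames

open Literature.Barriers.MatrixMultiplication (SubgroupTPP)

variable {p : ℕ} [hp : Fact p.Prime]

/-- **Two-member Borel frame.**  Two disjoint subgroups of `GL₂(𝔽_p)` of order divisible by `p` are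
simultaneously conjugate to `U⁺ ≤ K ≤ B⁺` and `U⁻ ≤ K' ≤ B⁻`. -/
theorem exists_borel_frame_of_disjoint {H H' : Subgroup (GLm p 2)} (hd : Disjoint H H')
    (h : p ∣ Nat.card H) (h' : p ∣ Nat.card H') :
    ∃ c : GLm p 2,
      (∀ k ∈ H.map (MulAut.conj c⁻¹).toMonoidHom, (k : Mat p 2) 1 0 = 0) ∧
      (∀ u : GLm p 2, (u : Mat p 2) 1 0 = 0 → (u : Mat p 2) 0 0 = 1 → (u : Mat p 2) 1 1 = 1 →
        u ∈ H.map (MulAut.conj c⁻¹).toMonoidHom) ∧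
      (∀ k ∈ H'.map (MulAut.conj c⁻¹).toMonoidHom, (k : Mat p 2) 0 1 = 0) ∧
      (∀ u : GLm p 2, (u : Mat p 2) 0 1 = 0 → (u : Mat p 2) 0 0 = 1 → (u : Mat p 2) 1 1 = 1 →
        u ∈ H'.map (MulAut.conj c⁻¹).toMonoidHom) := by
  obtain ⟨g, hg, hg1, hdet, v, hv, hfix⟩ := exists_transvection h
  obtain ⟨g', hg', hg'1, hdet', v', hv', hfix'⟩ := exists_transvection h'
  -- Step 1: distinct fixed lines.
  have hD : v 0 * v' 1 - v' 0 * v 1 ≠ 0 := fun e =>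
    not_disjoint_of_common_fixed hg hg' hg1 hg'1 hdet hdet' hv'
      (fixed_of_det_eq_zero hv hfix.1 hfix.2 e) hfix' hd
  -- Step 2: the frame `c = (v | v')` and the flip `w`.
  obtain ⟨c, c00, c01, c10, c11⟩ := exists_gl2 (v 0) (v' 0) (v 1) (v' 1) hD
  obtain ⟨w, w00, w01, w10, w11⟩ := exists_gl2 (0 : ZMod p) 1 1 0 (by simp)
  have hL := upper_le_map_conj (z := c) hg hg1 hdet (by rw [c00, c10]; exact hfix.1)
    (by rw [c00, c10]; exact hfix.2)
  have hcw0 : ((c * w : GLm p 2) : Mat p 2) 0 0 = v' 0 := by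
    rw [gl2_mul_apply, c00, c01, w00, w10]; ring
  have hcw1 : ((c * w : GLm p 2) : Mat p 2) 1 0 = v' 1 := by
    rw [gl2_mul_apply, c10, c11, w00, w10]; ring
  have hL' := upper_le_map_conj (z := c * w) hg' hg'1 hdet' (by rw [hcw0, hcw1]; exact hfix'.1)
    (by rw [hcw0, hcw1]; exact hfix'.2)
  have movw : ∀ {L : Subgroup (GLm p 2)} {x : GLm p 2},
      (w⁻¹ * x * w ∈ L.map (MulAut.conj (c * w)⁻¹).toMonoidHom ↔
        x ∈ L.map (MulAut.conj c⁻¹).toMonoidHom) := by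
    intro L x
    rw [mem_map_conj_inv_iff, mem_map_conj_inv_iff]
    have e : c * w * (w⁻¹ * x * w) * (c * w)⁻¹ = c * x * c⁻¹ := by group
    rw [e]
  -- Step 3: `U⁺ ≤ K = c⁻¹ H c`, `U⁻ ≤ K' = c⁻¹ H' c`, and `K ∩ K' = 1`.
  have hU : ∀ u : GLm p 2, (u : Mat p 2) 1 0 = 0 → (u : Mat p 2) 0 0 = 1 → (u : Mat p 2) 1 1 = 1 →
      u ∈ H.map (MulAut.conj c⁻¹).toMonoidHom := hL
  have hU' : ∀ u : GLm p 2, (u : Mat p 2) 0 1 = 0 → (u : Mat p 2) 0 0 = 1 → (u : Mat p 2) 1 1 = 1 →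
      u ∈ H'.map (MulAut.conj c⁻¹).toMonoidHom := by
    intro u h01 h00 h11
    obtain ⟨e00, -, e10, e11⟩ := conj_w_apply w00 w01 w10 w11 u
    exact movw.1 (hL' _ (by rw [e10, h01]) (by rw [e00, h11]) (by rw [e11, h00]))
  have hdK : Disjoint (H.map (MulAut.conj c⁻¹).toMonoidHom)
      (H'.map (MulAut.conj c⁻¹).toMonoidHom) := by
    rw [Subgroup.disjoint_def]
    intro x hx hx'
    rw [mem_map_conj_inv_iff] at hx hx'
    have e : c * x * c⁻¹ = 1 := Subgroup.disjoint_def.1 hd hx hx'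
    calc x = c⁻¹ * (c * x * c⁻¹) * c := by group
      _ = 1 := by rw [e]; group
  -- Two test unipotents `E₁₂(1)`, `E₂₁(1)`.
  obtain ⟨uU, uU00, uU01, uU10, uU11⟩ := exists_gl2 (1 : ZMod p) 1 0 1 (by simp)
  obtain ⟨uL, uL00, uL01, uL10, uL11⟩ := exists_gl2 (1 : ZMod p) 0 1 1 (by simp)
  have huU1 : uU ≠ 1 := fun e =>
    one_ne_zero (by rw [← uU01, e]; exact (gl2_one_apply (p := p)).2.1)
  have huL1 : uL ≠ 1 := fun e =>
    one_ne_zero (by rw [← uL10, e]; exact (gl2_one_apply (p := p)).2.2.1)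
  have huU := hU uU uU10 uU00 uU11
  have huL := hU' uL uL01 uL00 uL11
  -- Step 4: Borel containments, by the root lemma and disjointness.
  have hB : ∀ k ∈ H.map (MulAut.conj c⁻¹).toMonoidHom, (k : Mat p 2) 1 0 = 0 := by
    intro k hk
    by_contra hne
    exact huL1 (Subgroup.disjoint_def.1 hdK
      (lower_mem_of_upper_mem hU hk hne uL uL01 uL00 uL11) huL)
  have hB' : ∀ k ∈ H'.map (MulAut.conj c⁻¹).toMonoidHom, (k : Mat p 2) 0 1 = 0 := by
    intro k hk
    by_contra hne
    obtain ⟨-, -, e10, -⟩ := conj_w_apply w00 w01 w10 w11 k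
    have hlow := lower_mem_of_upper_mem hL' (movw.2 hk) (by rw [e10]; exact hne)
    obtain ⟨f00, f01, -, f11⟩ := conj_w_apply w00 w01 w10 w11 uU
    have huU' := movw.1 (hlow (w⁻¹ * uU * w) (by rw [f01, uU10]) (by rw [f00, uU11])
      (by rw [f11, uU00]))
    exact huU1 (Subgroup.disjoint_def.1 hdK huU huU')
  exact ⟨c, hB, hU, hB', hU'⟩

/-- **Two-member Borel frame in a TPP triple**, with the TPP transported to the conjugated
triple. -/
theorem exists_borel_frame_of_tpp {H₁ H₂ H₃ : Subgroup (GLm p 2)} (htpp : SubgroupTPP H₁ H₂ H₃)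
    (h₁ : p ∣ Nat.card H₁) (h₂ : p ∣ Nat.card H₂) :
    ∃ c : GLm p 2,
      (∀ k ∈ H₁.map (MulAut.conj c⁻¹).toMonoidHom, (k : Mat p 2) 1 0 = 0) ∧
      (∀ u : GLm p 2, (u : Mat p 2) 1 0 = 0 → (u : Mat p 2) 0 0 = 1 → (u : Mat p 2) 1 1 = 1 →
        u ∈ H₁.map (MulAut.conj c⁻¹).toMonoidHom) ∧
      (∀ k ∈ H₂.map (MulAut.conj c⁻¹).toMonoidHom, (k : Mat p 2) 0 1 = 0) ∧
      (∀ u : GLm p 2, (u : Mat p 2) 0 1 = 0 → (u : Mat p 2) 0 0 = 1 → (u : Mat p 2) 1 1 = 1 →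
        u ∈ H₂.map (MulAut.conj c⁻¹).toMonoidHom) ∧
      SubgroupTPP (H₁.map (MulAut.conj c⁻¹).toMonoidHom) (H₂.map (MulAut.conj c⁻¹).toMonoidHom)
        (H₃.map (MulAut.conj c⁻¹).toMonoidHom) := by
  obtain ⟨c, hB, hU, hB', hU'⟩ :=
    exists_borel_frame_of_disjoint (StandardLines.subgroupTPP_disjoint htpp).1 h₁ h₂
  exact ⟨c, hB, hU, hB', hU', subgroupTPP_map_of_injective _ (MulAut.conj c⁻¹).injective htpp⟩

/-- **Three-member decorated-Sylow frame.**  A subgroup TPP triple of `GL₂(𝔽_p)` all of whose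
members have order divisible by `p` is conjugate to a decorated-Sylow triple: `U⁺ ≤ K₁ ≤ B⁺`,
`U_{[1:1]} ≤ K₂ ≤ Stab[1:1]`, `U⁻ ≤ K₃ ≤ B⁻` (the six hypotheses of `decoratedSylow_volume_le`). -/
theorem exists_decorated_frame_of_threeSylow {H₁ H₂ H₃ : Subgroup (GLm p 2)}
    (htpp : SubgroupTPP H₁ H₂ H₃) (h₁ : p ∣ Nat.card H₁) (h₂ : p ∣ Nat.card H₂)
    (h₃ : p ∣ Nat.card H₃) :
    ∃ c : GLm p 2,
      (∀ h ∈ H₁.map (MulAut.conj c⁻¹).toMonoidHom, (h : Mat p 2) 1 0 = 0) ∧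
      (∀ u : GLm p 2, (u : Mat p 2) 1 0 = 0 → (u : Mat p 2) 0 0 = 1 → (u : Mat p 2) 1 1 = 1 →
        u ∈ H₁.map (MulAut.conj c⁻¹).toMonoidHom) ∧
      (∀ h ∈ H₂.map (MulAut.conj c⁻¹).toMonoidHom,
        (h : Mat p 2) 0 0 + (h : Mat p 2) 0 1 = (h : Mat p 2) 1 0 + (h : Mat p 2) 1 1) ∧
      (∀ u : GLm p 2,
        (u : Mat p 2) 0 0 + (u : Mat p 2) 0 1 = (u : Mat p 2) 1 0 + (u : Mat p 2) 1 1 →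
        (u : Mat p 2) 0 0 + (u : Mat p 2) 0 1 = 1 → (u : Mat p 2) 1 1 - (u : Mat p 2) 0 1 = 1 →
        u ∈ H₂.map (MulAut.conj c⁻¹).toMonoidHom) ∧
      (∀ h ∈ H₃.map (MulAut.conj c⁻¹).toMonoidHom, (h : Mat p 2) 0 1 = 0) ∧
      (∀ u : GLm p 2, (u : Mat p 2) 0 1 = 0 → (u : Mat p 2) 0 0 = 1 → (u : Mat p 2) 1 1 = 1 →
        u ∈ H₃.map (MulAut.conj c⁻¹).toMonoidHom) := by
  obtain ⟨d12, d13, d23⟩ := StandardLines.subgroupTPP_disjoint htpp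
  obtain ⟨g₁, hg₁, hg₁1, hdet₁, v₁, hv₁, hfix₁⟩ := exists_transvection h₁
  obtain ⟨g₂, hg₂, hg₂1, hdet₂, v₂, hv₂, hfix₂⟩ := exists_transvection h₂
  obtain ⟨g₃, hg₃, hg₃1, hdet₃, v₃, hv₃, hfix₃⟩ := exists_transvection h₃
  -- Step 1: the three fixed lines are pairwise distinct.
  have hD12 : v₁ 0 * v₂ 1 - v₂ 0 * v₁ 1 ≠ 0 := fun hD =>
    not_disjoint_of_common_fixed hg₁ hg₂ hg₁1 hg₂1 hdet₁ hdet₂ hv₂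
      (fixed_of_det_eq_zero hv₁ hfix₁.1 hfix₁.2 hD) hfix₂ d12
  have hD13 : v₁ 0 * v₃ 1 - v₃ 0 * v₁ 1 ≠ 0 := fun hD =>
    not_disjoint_of_common_fixed hg₁ hg₃ hg₁1 hg₃1 hdet₁ hdet₃ hv₃
      (fixed_of_det_eq_zero hv₁ hfix₁.1 hfix₁.2 hD) hfix₃ d13
  have hD23 : v₂ 0 * v₃ 1 - v₃ 0 * v₂ 1 ≠ 0 := fun hD =>
    not_disjoint_of_common_fixed hg₂ hg₃ hg₂1 hg₃1 hdet₂ hdet₃ hv₃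
      (fixed_of_det_eq_zero hv₂ hfix₂.1 hfix₂.2 hD) hfix₃ d23
  -- Step 2: the frame `c = (α v₁ | β v₃)` with `α v₁ + β v₃ = v₂`.
  obtain ⟨α, hα⟩ : ∃ α : ZMod p, α = (v₂ 0 * v₃ 1 - v₃ 0 * v₂ 1) / (v₁ 0 * v₃ 1 - v₃ 0 * v₁ 1) :=
    ⟨_, rfl⟩
  obtain ⟨β, hβ⟩ : ∃ β : ZMod p, β = (v₁ 0 * v₂ 1 - v₂ 0 * v₁ 1) / (v₁ 0 * v₃ 1 - v₃ 0 * v₁ 1) :=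
    ⟨_, rfl⟩
  have hα0 : α ≠ 0 := hα ▸ div_ne_zero hD23 hD13
  have hβ0 : β ≠ 0 := hβ ▸ div_ne_zero hD12 hD13
  have hsum0 : α * v₁ 0 + β * v₃ 0 = v₂ 0 := by
    rw [hα, hβ, div_mul_eq_mul_div, div_mul_eq_mul_div, ← add_div, div_eq_iff hD13]
    ring
  have hsum1 : α * v₁ 1 + β * v₃ 1 = v₂ 1 := by
    rw [hα, hβ, div_mul_eq_mul_div, div_mul_eq_mul_div, ← add_div, div_eq_iff hD13]
    ring
  obtain ⟨c, c00, c01, c10, c11⟩ :=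
    exists_gl2 (α * v₁ 0) (β * v₃ 0) (α * v₁ 1) (β * v₃ 1) (by
      have e : α * v₁ 0 * (β * v₃ 1) - β * v₃ 0 * (α * v₁ 1) =
          α * β * (v₁ 0 * v₃ 1 - v₃ 0 * v₁ 1) := by ring
      rw [e]
      exact mul_ne_zero (mul_ne_zero hα0 hβ0) hD13)
  obtain ⟨m, m00, m01, m10, m11⟩ := exists_gl2 (1 : ZMod p) 0 1 1 (by simp)
  obtain ⟨w, w00, w01, w10, w11⟩ := exists_gl2 (0 : ZMod p) 1 1 0 (by simp)
  -- Step 3: `U⁺ ≤ c⁻¹ H₁ c`, `U⁺ ≤ (c m)⁻¹ H₂ (c m)`, `U⁺ ≤ (c w)⁻¹ H₃ (c w)`.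
  have hL₁ := upper_le_map_conj (z := c) hg₁ hg₁1 hdet₁
    (by rw [c00, c10]; linear_combination α * hfix₁.1)
    (by rw [c00, c10]; linear_combination α * hfix₁.2)
  have hcm0 : ((c * m : GLm p 2) : Mat p 2) 0 0 = v₂ 0 := by
    rw [gl2_mul_apply, c00, c01, m00, m10, mul_one, mul_one, hsum0]
  have hcm1 : ((c * m : GLm p 2) : Mat p 2) 1 0 = v₂ 1 := by
    rw [gl2_mul_apply, c10, c11, m00, m10, mul_one, mul_one, hsum1]
  have hL₂ := upper_le_map_conj (z := c * m) hg₂ hg₂1 hdet₂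
    (by rw [hcm0, hcm1]; exact hfix₂.1) (by rw [hcm0, hcm1]; exact hfix₂.2)
  have hcw0 : ((c * w : GLm p 2) : Mat p 2) 0 0 = β * v₃ 0 := by
    rw [gl2_mul_apply, c00, c01, w00, w10]; ring
  have hcw1 : ((c * w : GLm p 2) : Mat p 2) 1 0 = β * v₃ 1 := by
    rw [gl2_mul_apply, c10, c11, w00, w10]; ring
  have hL₃ := upper_le_map_conj (z := c * w) hg₃ hg₃1 hdet₃
    (by rw [hcw0, hcw1]; linear_combination β * hfix₃.1)
    (by rw [hcw0, hcw1]; linear_combination β * hfix₃.2)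
  -- Transfer between the frames `c m`, `c w` and `c`.
  have movm : ∀ {H : Subgroup (GLm p 2)} {x : GLm p 2},
      (m⁻¹ * x * m ∈ H.map (MulAut.conj (c * m)⁻¹).toMonoidHom ↔
        x ∈ H.map (MulAut.conj c⁻¹).toMonoidHom) := by
    intro H x
    rw [mem_map_conj_inv_iff, mem_map_conj_inv_iff]
    have e : c * m * (m⁻¹ * x * m) * (c * m)⁻¹ = c * x * c⁻¹ := by group
    rw [e]
  have movw : ∀ {H : Subgroup (GLm p 2)} {x : GLm p 2},
      (w⁻¹ * x * w ∈ H.map (MulAut.conj (c * w)⁻¹).toMonoidHom ↔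
        x ∈ H.map (MulAut.conj c⁻¹).toMonoidHom) := by
    intro H x
    rw [mem_map_conj_inv_iff, mem_map_conj_inv_iff]
    have e : c * w * (w⁻¹ * x * w) * (c * w)⁻¹ = c * x * c⁻¹ := by group
    rw [e]
  -- Step 4: the conjugated triple `Kᵢ = c⁻¹ Hᵢ c` and its unipotent subgroups.
  have htppK : SubgroupTPP (H₁.map (MulAut.conj c⁻¹).toMonoidHom)
      (H₂.map (MulAut.conj c⁻¹).toMonoidHom) (H₃.map (MulAut.conj c⁻¹).toMonoidHom) :=
    subgroupTPP_map_of_injective _ (MulAut.conj c⁻¹).injective htpp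
  obtain ⟨-, dK13, dK23⟩ := StandardLines.subgroupTPP_disjoint htppK
  have hU₁ : ∀ u : GLm p 2, (u : Mat p 2) 1 0 = 0 → (u : Mat p 2) 0 0 = 1 → (u : Mat p 2) 1 1 = 1 →
      u ∈ H₁.map (MulAut.conj c⁻¹).toMonoidHom := hL₁
  have hU₂ : ∀ u : GLm p 2, (u : Mat p 2) 0 0 + (u : Mat p 2) 0 1 = (u : Mat p 2) 1 0 +
      (u : Mat p 2) 1 1 → (u : Mat p 2) 0 0 + (u : Mat p 2) 0 1 = 1 →
      (u : Mat p 2) 1 1 - (u : Mat p 2) 0 1 = 1 → u ∈ H₂.map (MulAut.conj c⁻¹).toMonoidHom := by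
    intro u hs h1 h2
    obtain ⟨e00, -, e10, e11⟩ := conj_m_apply m00 m01 m10 m11 u
    exact movm.1 (hL₂ _ (by rw [e10, ← hs, sub_self]) (by rw [e00, h1]) (by rw [e11, h2]))
  have hU₃ : ∀ u : GLm p 2, (u : Mat p 2) 0 1 = 0 → (u : Mat p 2) 0 0 = 1 → (u : Mat p 2) 1 1 = 1 →
      u ∈ H₃.map (MulAut.conj c⁻¹).toMonoidHom := by
    intro u h01 h00 h11
    obtain ⟨e00, -, e10, e11⟩ := conj_w_apply w00 w01 w10 w11 u
    exact movw.1 (hL₃ _ (by rw [e10, h01]) (by rw [e00, h11]) (by rw [e11, h00]))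
  -- Two test unipotents `E₁₂(1)`, `E₂₁(1)`.
  obtain ⟨uU, uU00, uU01, uU10, uU11⟩ := exists_gl2 (1 : ZMod p) 1 0 1 (by simp)
  obtain ⟨uL, uL00, uL01, uL10, uL11⟩ := exists_gl2 (1 : ZMod p) 0 1 1 (by simp)
  have huU1 : uU ≠ 1 := fun h =>
    one_ne_zero (by rw [← uU01, h]; exact (gl2_one_apply (p := p)).2.1)
  have huL1 : uL ≠ 1 := fun h =>
    one_ne_zero (by rw [← uL10, h]; exact (gl2_one_apply (p := p)).2.2.1)
  have huU₁ := hU₁ uU uU10 uU00 uU11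
  have huL₃ := hU₃ uL uL01 uL00 uL11
  -- Step 5: Borel containments, by the root lemma and disjointness.
  have hB₁ : ∀ h ∈ H₁.map (MulAut.conj c⁻¹).toMonoidHom, (h : Mat p 2) 1 0 = 0 := by
    intro h hh
    by_contra hne
    exact huL1 (Subgroup.disjoint_def.1 dK13
      (lower_mem_of_upper_mem hU₁ hh hne uL uL01 uL00 uL11) huL₃)
  have hB₃ : ∀ h ∈ H₃.map (MulAut.conj c⁻¹).toMonoidHom, (h : Mat p 2) 0 1 = 0 := by
    intro h hh
    by_contra hne
    obtain ⟨-, -, e10, -⟩ := conj_w_apply w00 w01 w10 w11 h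
    have hlow := lower_mem_of_upper_mem hL₃ (movw.2 hh) (by rw [e10]; exact hne)
    obtain ⟨f00, f01, -, f11⟩ := conj_w_apply w00 w01 w10 w11 uU
    have huU₃ := movw.1 (hlow (w⁻¹ * uU * w) (by rw [f01, uU10]) (by rw [f00, uU11])
      (by rw [f11, uU00]))
    exact huU1 (Subgroup.disjoint_def.1 dK13 huU₁ huU₃)
  have hB₂ : ∀ h ∈ H₂.map (MulAut.conj c⁻¹).toMonoidHom,
      (h : Mat p 2) 0 0 + (h : Mat p 2) 0 1 = (h : Mat p 2) 1 0 + (h : Mat p 2) 1 1 := by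
    intro h hh
    by_contra hne
    obtain ⟨-, -, e10, -⟩ := conj_m_apply m00 m01 m10 m11 h
    have hlow := lower_mem_of_upper_mem hL₂ (movm.2 hh)
      (by rw [e10]; exact sub_ne_zero.2 (Ne.symm hne))
    obtain ⟨f00, f01, -, f11⟩ := conj_m_apply m00 m01 m10 m11 uL
    have huL₂ := movm.1 (hlow (m⁻¹ * uL * m) (by rw [f01, uL01])
      (by rw [f00, uL00, uL01, add_zero]) (by rw [f11, uL11, uL01, sub_zero]))
    exact huL1 (Subgroup.disjoint_def.1 dK23 huL₂ huL₃)
  exact ⟨c, hB₁, hU₁, hB₂, hU₂, hB₃, hU₃⟩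

end SylowFrames

end Summit.MatrixMultiplication.MatrixMultiplication.Theorems.SubgroupIdentityDesigns.Negative
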